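import Summits.BirchSwinnertonDyer.BirchSwinnertonDyer.Theorems.CyclotomicUntwistNineIntegers
import HarnessLib

/-!
# The ring `𝓞 = integralClosure ℤ₃ ℚ₃(ζ₉)` of the LOCAL currency of `DescendedFrobeniusMatrix`, II: the residue field
# `𝓞/(1 − ζ₉)𝓞 = 𝔽₃` and the EXISTENCE of a reduction map `ρ : 𝓞 →+* ZMod 3`, with `ρ(ζ₉) = 1` for every `ρ`

Cell `pub/bsd-wall` (D-0145 line `route-BirchSwinnertonDyer-CyclotomicUntwist`), seat `bsd-line-cycu-p4` (gen 7),
helper toward K1 `PSRankOneLowerHalfAtThree` (stmt-BirchSwinnertonDyer-21580) / K2 (21581), registered line `dfrob`,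
stub **S2 `stub_descendedFrobenius`** — its LOCAL half. Sequel of `CyclotomicUntwistNineIntegers.lean`. THEOREMS ONLY
(no definition, no named fact, no `sorry`); BSD is not proved by this file and no crux is.

* §4 **`𝓞/(1 − ζ₉)𝓞 = 𝔽₃`**: every `x ∈ 𝓞` satisfies `x − a ∈ (1 − ζ₉)𝓞` for an integer `a`
  (`exists_int_sub_eq_mul`), unique modulo `3` (`int_residue_unique`). PROOF (the fundamental inequality
  `e·f ≤ n` made explicit, Serre *Local Fields* II §3): if `x` had no residue digit, a `ℚ₃`-linear dependence among
  the twelve elements `xⁱ(1 − ζ₉)ʲ` (`i < 2`, `j < 6`; dependent because `[K : ℚ₃] ≤ 9`, `finrank_le_nine`),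
  normalised so that one coefficient is `1` and all lie in `ℤ₃`, is peeled power by power of the uniformizer
  (`norm_lt_one_of_relation`, step `NineIntegers.norm_lt_one_of_residueFree`) until every coefficient lies in `3ℤ₃`
  — contradiction at the unit coefficient.
* §5 **`Nonempty (ONine →+* ZMod 3)`** (`nonempty_residueMap`: the digit map is a ring homomorphism), and for EVERY
  `ρ : 𝓞 →+* ZMod 3`: `ρ(ζ₉) = 1` (`𝔽₃` has no ninth root of unity but `1`), `ρ(1 − ζ₉) = 0`, `ρ(θ) = ρ(θ⁻¹) = 1`,
  and `ρ x = a` whenever `x − a ∈ (1 − ζ₉)𝓞` (`residueMap_eq_of_sub_eq_mul`) — so the special fibre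
  `NineGoodModel.specialFibre ρ` of an explicit model over `𝓞` is computed identically by every `ρ`, and the
  quantification `∀ ρ` in `isDescendedFrobeniusMatrix_exists` / `specialFibreTrace` is not vacuous.

References: J.-P. Serre, *Local Fields*, GTM 67, I §4 and II §3 [SerreLocalFields1979]; L. C. Washington,
*Introduction to Cyclotomic Fields*, GTM 83, Lemma 1.4 [Washington1997].
-/

noncomputable section

open scoped Polynomial

open Polynomial IsCyclotomicExtension Literature.NumberTheory.EllipticCurves.DescendedFrobenius
  Summit.BirchSwinnertonDyer.BirchSwinnertonDyer.Theorems Summit.BirchSwinnertonDyer.Rank1Residual.O5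

-- single-conjunct summit: `Summit.BirchSwinnertonDyer.BirchSwinnertonDyer.…` repeats the name by design
set_option linter.dupNamespace false
set_option autoImplicit false

namespace Summit.BirchSwinnertonDyer.BirchSwinnertonDyer.Theorems.NineIntegers

/-- **Peeling the powers of the uniformizer.** For `x ∈ 𝓞` with no residue in `𝔽₃`, a relation
`Σ_{j<6} (c₀ⱼ + c₁ⱼ·x)·(1 − ζ₉)ʲ = 0` with all `cᵢⱼ ∈ ℤ₃` forces every `cᵢⱼ ∈ 3ℤ₃` (induction on `j`: the terms
below `j` are divisible by `3 = −(1 − ζ₉)⁶θ⁻¹`, hence by `(1 − ζ₉)^{j+1}`, the terms above `j` visibly; cancel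
`(1 − ζ₉)ʲ` and apply `norm_lt_one_of_residueFree`). [folklore] -/
theorem norm_lt_one_of_relation {x : KNine} (hx : x ∈ ONine)
    (H : ∀ (a : ℤ) (y : KNine), y ∈ ONine → x - a ≠ (1 - zeta 9 ℚ_[3] KNine) * y)
    (c₀ c₁ : ℕ → ℚ_[3]) (h₀ : ∀ j, ‖c₀ j‖ ≤ 1) (h₁ : ∀ j, ‖c₁ j‖ ≤ 1)
    (hrel : ∑ j ∈ Finset.range 6, (algebraMap ℚ_[3] KNine (c₀ j) + algebraMap ℚ_[3] KNine (c₁ j) * x)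
      * (1 - zeta 9 ℚ_[3] KNine) ^ j = 0) :
    ∀ j < 6, ‖c₀ j‖ < 1 ∧ ‖c₁ j‖ < 1 := by
  set ζ := zeta 9 ℚ_[3] KNine with hζdef
  set φ := algebraMap ℚ_[3] KNine with hφ
  have h3 := three_eq_neg_pow_six_mul_thetaInv zeta_spec
  rw [← hζdef] at h3
  have h3φ : φ 3 = 3 := map_ofNat φ 3
  have hπ0 : (1 - ζ) ≠ 0 := GNine.one_sub_zeta_ne_zero zeta_spec
  -- the generic term and its membership
  have ht : ∀ j, φ (c₀ j) + φ (c₁ j) * x ∈ ONine := fun j =>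
    add_mem (algebraMap_mem_of_norm_le_one (h₀ j)) (mul_mem (algebraMap_mem_of_norm_le_one (h₁ j)) hx)
  have key : ∀ k ≤ 6, ∀ j < k, ‖c₀ j‖ < 1 ∧ ‖c₁ j‖ < 1 := by
    intro k
    induction k with
    | zero => intro _ j hj; exact absurd hj (Nat.not_lt_zero j)
    | succ k IH =>
      intro hk j hj
      have IH' := IH (by omega)
      rcases Nat.lt_succ_iff_lt_or_eq.mp hj with hjk | rfl
      · exact IH' j hjk
      · -- the step at index `j` (`j < 6`, all lower coefficients already in `3ℤ₃`)
        have hj6 : j < 6 := by omega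
        -- lower part: `t_i = 3 s_i`
        have hlow : ∑ i ∈ Finset.range j, (φ (c₀ i) + φ (c₁ i) * x) * (1 - ζ) ^ i =
            3 * ∑ i ∈ Finset.range j, (φ (c₀ i / 3) + φ (c₁ i / 3) * x) * (1 - ζ) ^ i := by
          rw [Finset.mul_sum]
          refine Finset.sum_congr rfl fun i hi => ?_
          have e0 : φ (c₀ i) = 3 * φ (c₀ i / 3) := by rw [← h3φ, ← map_mul]; congr 1; ring
          have e1 : φ (c₁ i) = 3 * φ (c₁ i / 3) := by rw [← h3φ, ← map_mul]; congr 1; ring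
          rw [e0, e1]; ring
        have hA : ∑ i ∈ Finset.range j, (φ (c₀ i / 3) + φ (c₁ i / 3) * x) * (1 - ζ) ^ i ∈ ONine := by
          refine sum_mem fun i hi => ?_
          have hij : i < j := Finset.mem_range.mp hi
          exact mul_mem (add_mem (algebraMap_mem_of_norm_le_one (FlexTangent.norm_div_three_le_one (IH' i hij).1))
            (mul_mem (algebraMap_mem_of_norm_le_one (FlexTangent.norm_div_three_le_one (IH' i hij).2)) hx))
            (pow_mem one_sub_zeta_mem i)
        -- upper part: `(1 - ζ)^i = (1 - ζ)^(j+1) · (1 - ζ)^(i - (j+1))`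
        have hup : ∑ i ∈ Finset.Ico (j + 1) 6, (φ (c₀ i) + φ (c₁ i) * x) * (1 - ζ) ^ i =
            (1 - ζ) ^ (j + 1) *
              ∑ i ∈ Finset.Ico (j + 1) 6, (φ (c₀ i) + φ (c₁ i) * x) * (1 - ζ) ^ (i - (j + 1)) := by
          rw [Finset.mul_sum]
          refine Finset.sum_congr rfl fun i hi => ?_
          have hle : j + 1 ≤ i := (Finset.mem_Ico.mp hi).1
          rw [show (1 - ζ) ^ i = (1 - ζ) ^ (j + 1) * (1 - ζ) ^ (i - (j + 1)) by
            rw [← pow_add, Nat.add_sub_cancel' hle]]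
          ring
        have hB : ∑ i ∈ Finset.Ico (j + 1) 6, (φ (c₀ i) + φ (c₁ i) * x) * (1 - ζ) ^ (i - (j + 1)) ∈ ONine :=
          sum_mem fun i _ => mul_mem (ht i) (pow_mem one_sub_zeta_mem _)
        -- the relation split at `j`
        have hsplit := hrel
        rw [← Finset.sum_range_add_sum_Ico _ hj6.le, Finset.sum_eq_sum_Ico_succ_bot hj6, hlow, hup]
          at hsplit
        have e6 : (1 - ζ) ^ 6 = (1 - ζ) ^ (j + 1) * (1 - ζ) ^ (5 - j) := by
          rw [← pow_add]; congr 1; omega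
        set A := ∑ i ∈ Finset.range j, (φ (c₀ i / 3) + φ (c₁ i / 3) * x) * (1 - ζ) ^ i with hAdef
        set B := ∑ i ∈ Finset.Ico (j + 1) 6, (φ (c₀ i) + φ (c₁ i) * x) * (1 - ζ) ^ (i - (j + 1))
          with hBdef
        set θi := (-10 - 11 * ζ - 7 * ζ ^ 2 - 10 * ζ ^ 3 - 4 * ζ ^ 4 + 4 * ζ ^ 5) with hθi
        -- `t_j (1-ζ)^j = (1-ζ)^(j+1) · W`
        have hW : (φ (c₀ j) + φ (c₁ j) * x) * (1 - ζ) ^ j =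
            ((1 - ζ) * ((1 - ζ) ^ (5 - j) * θi * A - B)) * (1 - ζ) ^ j := by
          have e : (φ (c₀ j) + φ (c₁ j) * x) * (1 - ζ) ^ j = -(3 * A) - (1 - ζ) ^ (j + 1) * B := by
            linear_combination hsplit
          rw [e, h3, e6]; ring
        have ht_eq : φ (c₀ j) + φ (c₁ j) * x = (1 - ζ) * ((1 - ζ) ^ (5 - j) * θi * A - B) :=
          mul_right_cancel₀ (pow_ne_zero j hπ0) hW
        exact norm_lt_one_of_residueFree hx H (h₀ j) (h₁ j)
          (sub_mem (mul_mem (mul_mem (pow_mem one_sub_zeta_mem _) thetaInv_mem) hA) hB) ht_eq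
  exact key 6 le_rfl

/-- `[ℚ₃(ζ₉) : ℚ₃] ≤ 9` (`ζ₉` generates and is a root of `X⁹ − 1`; the true value `6` is not needed).
[folklore] -/
theorem finrank_le_nine : Module.finrank ℚ_[3] KNine ≤ 9 := by
  haveI : Module.Finite ℚ_[3] KNine := IsCyclotomicExtension.finite {9} ℚ_[3] KNine
  have hζ := zeta_spec
  rw [(IsPrimitiveRoot.powerBasis ℚ_[3] hζ).finrank, IsPrimitiveRoot.powerBasis_dim]
  have hdvd : minpoly ℚ_[3] (zeta 9 ℚ_[3] KNine) ∣ (X ^ 9 - C 1 : ℚ_[3][X]) := by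
    apply minpoly.dvd
    simp [hζ.pow_eq_one]
  have h9 : (X ^ 9 - C 1 : ℚ_[3][X]).natDegree = 9 := natDegree_X_pow_sub_C
  have hne : (X ^ 9 - C 1 : ℚ_[3][X]) ≠ 0 := X_pow_sub_C_ne_zero (by norm_num) 1
  calc (minpoly ℚ_[3] (zeta 9 ℚ_[3] KNine)).natDegree ≤ (X ^ 9 - C 1 : ℚ_[3][X]).natDegree :=
        natDegree_le_of_dvd hdvd hne
    _ = 9 := h9

/-- **The residue field of `𝓞` is `𝔽₃`: every `x ∈ 𝓞` is `≡` an integer modulo `(1 − ζ₉)𝓞`.** Proof: otherwise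
the `12` elements `xⁱ(1 − ζ₉)ʲ` (`i < 2`, `j < 6`) would be `ℚ₃`-linearly independent
(`norm_lt_one_of_relation` applied to a dependence normalised to have a unit coefficient), against
`[ℚ₃(ζ₉) : ℚ₃] ≤ 9` — the fundamental inequality `e·f ≤ n` made explicit for `ℚ₃(ζ₉)`, `e = 6`, `f = 1`
(Serre, *Local Fields* I §4, II §3). [folklore] -/
theorem exists_int_sub_eq_mul (x : KNine) (hx : x ∈ ONine) :
    ∃ (a : ℤ) (y : KNine), y ∈ ONine ∧ x - a = (1 - zeta 9 ℚ_[3] KNine) * y := by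
  by_contra H'
  have H : ∀ (a : ℤ) (y : KNine), y ∈ ONine → x - a ≠ (1 - zeta 9 ℚ_[3] KNine) * y :=
    fun a y hy h => H' ⟨a, y, hy, h⟩
  set ζ := zeta 9 ℚ_[3] KNine with hζdef
  set φ := algebraMap ℚ_[3] KNine with hφ
  haveI : Module.Finite ℚ_[3] KNine := IsCyclotomicExtension.finite {9} ℚ_[3] KNine
  let v : Fin 2 × Fin 6 → KNine := fun p => x ^ (p.1 : ℕ) * (1 - ζ) ^ (p.2 : ℕ)
  have hdep : ¬ LinearIndependent ℚ_[3] v := by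
    intro hli
    have h := hli.fintype_card_le_finrank
    have h9 := finrank_le_nine
    simp only [Fintype.card_prod, Fintype.card_fin] at h
    omega
  obtain ⟨g, hsum, i₀, hi₀⟩ := Fintype.not_linearIndependent_iff.mp hdep
  obtain ⟨m, -, hm⟩ := Finset.exists_max_image Finset.univ (fun i => ‖g i‖) Finset.univ_nonempty
  have hgm : g m ≠ 0 := by
    intro h0
    apply hi₀
    have := hm i₀ (Finset.mem_univ _)
    rw [h0, norm_zero] at this
    exact norm_le_zero_iff.mp this
  have hc : ∀ p, ‖g p / g m‖ ≤ 1 := fun p => by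
    rw [norm_div]
    exact div_le_one_of_le₀ (hm p (Finset.mem_univ _)) (norm_nonneg _)
  -- the normalised coefficients, as functions on `ℕ`
  let c₀ : ℕ → ℚ_[3] := fun j => if h : j < 6 then g (0, ⟨j, h⟩) / g m else 0
  let c₁ : ℕ → ℚ_[3] := fun j => if h : j < 6 then g (1, ⟨j, h⟩) / g m else 0
  have h₀ : ∀ j, ‖c₀ j‖ ≤ 1 := by
    intro j; by_cases h : j < 6
    · simp only [c₀, dif_pos h]; exact hc _
    · simp only [c₀, dif_neg h, norm_zero]; exact zero_le_one
  have h₁ : ∀ j, ‖c₁ j‖ ≤ 1 := by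
    intro j; by_cases h : j < 6
    · simp only [c₁, dif_pos h]; exact hc _
    · simp only [c₁, dif_neg h, norm_zero]; exact zero_le_one
  -- the relation, divided by `g m` and regrouped along `j`
  have hrel : ∑ j ∈ Finset.range 6, (φ (c₀ j) + φ (c₁ j) * x) * (1 - ζ) ^ j = 0 := by
    have h1 : ∑ p, (g p / g m) • v p = 0 := by
      have := congrArg (fun z => (g m)⁻¹ • z) hsum
      simp only [Finset.smul_sum, smul_smul, smul_zero] at this
      rw [← this]
      refine Finset.sum_congr rfl fun p _ => ?_
      rw [div_eq_inv_mul]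
    rw [Fintype.sum_prod_type, Fin.sum_univ_two, ← Finset.sum_add_distrib] at h1
    rw [← Fin.sum_univ_eq_sum_range (fun j => (φ (c₀ j) + φ (c₁ j) * x) * (1 - ζ) ^ j) 6, ← h1]
    refine Finset.sum_congr rfl fun j _ => ?_
    simp only [c₀, c₁, dif_pos j.2, Fin.eta, v, Algebra.smul_def, Fin.val_zero, Fin.val_one, pow_zero,
      pow_one]
    ring
  have hall := norm_lt_one_of_relation hx H c₀ c₁ h₀ h₁ hrel
  -- at the index `m` the coefficient is `g m / g m = 1`, not of norm `< 1`
  obtain ⟨i, j⟩ := m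
  have hone : ‖g (i, j) / g (i, j)‖ < 1 := by
    fin_cases i
    · have := (hall j j.2).1
      simpa only [c₀, dif_pos j.2, Fin.eta, Fin.zero_eta] using this
    · have := (hall j j.2).2
      simpa only [c₁, dif_pos j.2, Fin.eta, Fin.mk_one] using this
  rw [div_self hgm, norm_one] at hone
  exact lt_irrefl _ hone

/-- **Uniqueness of the residue**: two integers congruent to the same `x` modulo `(1 − ζ₉)𝓞` are congruent
modulo `3` (`1 − ζ₉` is not a unit of `𝓞` and `3 ∈ (1 − ζ₉)𝓞`; Bézout in `ℤ`). [folklore] -/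
theorem int_residue_unique {x : KNine} {a b : ℤ} {y y' : KNine} (hy : y ∈ ONine) (hy' : y' ∈ ONine)
    (ha : x - a = (1 - zeta 9 ℚ_[3] KNine) * y) (hb : x - b = (1 - zeta 9 ℚ_[3] KNine) * y') :
    (3 : ℤ) ∣ a - b := by
  by_contra hnd
  set ζ := zeta 9 ℚ_[3] KNine with hζdef
  have h3 := three_eq_neg_pow_six_mul_thetaInv zeta_spec
  rw [← hζdef] at h3
  -- Bézout: `u (a - b) + w · 3 = 1`
  have hcop : IsCoprime (a - b) 3 := by
    rw [Int.isCoprime_iff_gcd_eq_one]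
    have hp : Nat.Prime (Int.gcd (a - b) 3) ∨ Int.gcd (a - b) 3 = 1 := by
      have hdvd3 : (Int.gcd (a - b) 3 : ℤ) ∣ 3 := Int.gcd_dvd_right _ _
      have h' : Int.gcd (a - b) 3 ∣ 3 := by exact_mod_cast hdvd3
      rcases (Nat.dvd_prime Nat.prime_three).mp h' with h | h
      · exact Or.inr h
      · exact Or.inl (h ▸ Nat.prime_three)
    rcases hp with hp | hp
    · exfalso
      have hg3 : (Int.gcd (a - b) 3 : ℤ) ∣ 3 := Int.gcd_dvd_right _ _
      have hga : (Int.gcd (a - b) 3 : ℤ) ∣ a - b := Int.gcd_dvd_left _ _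
      have : Int.gcd (a - b) 3 = 3 := by
        have h' : Int.gcd (a - b) 3 ∣ 3 := by exact_mod_cast hg3
        rcases (Nat.dvd_prime Nat.prime_three).mp h' with h | h
        · rw [h] at hp; exact absurd hp Nat.not_prime_one
        · exact h
      rw [this] at hga
      exact hnd (by exact_mod_cast hga)
    · exact hp
  obtain ⟨u, w, huw⟩ := hcop
  have hab : ((a : KNine) - (b : KNine)) = (1 - ζ) * (y' - y) := by linear_combination hb - ha
  apply one_sub_zeta_mul_ne_one (y := (u : KNine) * (y' - y)
      - (w : KNine) * (1 - ζ) ^ 5 * (-10 - 11 * ζ - 7 * ζ ^ 2 - 10 * ζ ^ 3 - 4 * ζ ^ 4 + 4 * ζ ^ 5))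
    (sub_mem (mul_mem (intCast_mem ONine u) (sub_mem hy' hy))
      (mul_mem (mul_mem (intCast_mem ONine w) (pow_mem one_sub_zeta_mem 5)) thetaInv_mem))
  have huwK : (u : KNine) * ((a : KNine) - (b : KNine)) + (w : KNine) * 3 = 1 := by exact_mod_cast huw
  rw [← hζdef]
  linear_combination huwK - (u : KNine) * hab - (w : KNine) * h3

/-! ### §5 The reduction map `ρ : 𝓞 →+* 𝔽₃` -/

/-- **EXISTENCE of a reduction map `ρ : 𝓞 →+* ZMod 3`** (`𝓞 = integralClosure ℤ₃ ℚ₃(ζ₉)`, the ring over which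
the good models `NineGoodModel` of `Literature.DescendedFrobeniusMatrix` live): send `x` to its residue digit
(`exists_int_sub_eq_mul`, well defined by `int_residue_unique`). Its kernel is the maximal ideal `(1 − ζ₉)𝓞`; the
named fact `isDescendedFrobeniusMatrix_exists` and `NineGoodModel.specialFibreTrace` quantify over such `ρ`, and
this theorem says the quantification is not vacuous. [folklore] -/
theorem nonempty_residueMap : Nonempty (ONine →+* ZMod 3) := by
  classical
  -- the digit
  let d : ONine → ℤ := fun x => (exists_int_sub_eq_mul x.1 x.2).choose
  have hd : ∀ x : ONine, ∃ y : KNine, y ∈ ONine ∧ (x : KNine) - d x = (1 - zeta 9 ℚ_[3] KNine) * y :=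
    fun x => (exists_int_sub_eq_mul x.1 x.2).choose_spec
  -- well-definedness: any witness computes the digit mod 3
  have hdig : ∀ (x : ONine) (a : ℤ) (y : KNine), y ∈ ONine → (x : KNine) - a = (1 - zeta 9 ℚ_[3] KNine) * y →
      ((d x : ℤ) : ZMod 3) = a := by
    intro x a y hy h
    obtain ⟨y₀, hy₀, h₀⟩ := hd x
    exact (ZMod.intCast_eq_intCast_iff_dvd_sub (d x) a 3).mpr (int_residue_unique hy hy₀ h h₀)
  refine ⟨{ toFun := fun x => ((d x : ℤ) : ZMod 3),
             map_one' := ?_, map_mul' := ?_, map_zero' := ?_, map_add' := ?_ }⟩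
  · have := hdig 1 1 0 (zero_mem _) (by simp)
    simpa using this
  · intro x y
    obtain ⟨u, hu, hux⟩ := hd x
    obtain ⟨v, hv, hvy⟩ := hd y
    have key := hdig (x * y) (d x * d y) ((x : KNine) * v + (d y : KNine) * u)
      (add_mem (mul_mem x.2 hv) (mul_mem (intCast_mem ONine _) hu)) (by
        push_cast
        linear_combination (x : KNine) * hvy + (d y : KNine) * hux)
    simpa using key
  · have := hdig 0 0 0 (zero_mem _) (by simp)
    simpa using this
  · intro x y
    obtain ⟨u, hu, hux⟩ := hd x
    obtain ⟨v, hv, hvy⟩ := hd y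
    have key := hdig (x + y) (d x + d y) (u + v) (add_mem hu hv) (by
        push_cast
        linear_combination hux + hvy)
    simpa using key

/-- **Every reduction map sends `ζ₉` to `1`** (`ρ(ζ₉)⁹ = 1` in `𝔽₃`, whose only ninth root of unity is `1`).
[folklore] -/
theorem residueMap_zeta (ρ : ONine →+* ZMod 3) : ρ ⟨zeta 9 ℚ_[3] KNine, zeta_mem⟩ = 1 := by
  have h9 : (ρ ⟨zeta 9 ℚ_[3] KNine, zeta_mem⟩) ^ 9 = 1 := by
    rw [← map_pow, ← map_one ρ]
    congr 1
    apply Subtype.ext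
    simp [zeta_spec.pow_eq_one]
  have key : ∀ u : ZMod 3, u ^ 9 = 1 → u = 1 := by decide
  exact key _ h9

/-- Every reduction map kills the uniformizer: `ρ(1 − ζ₉) = 0`. [folklore] -/
theorem residueMap_one_sub_zeta (ρ : ONine →+* ZMod 3) :
    ρ ⟨1 - zeta 9 ℚ_[3] KNine, one_sub_zeta_mem⟩ = 0 := by
  have e : (⟨1 - zeta 9 ℚ_[3] KNine, one_sub_zeta_mem⟩ : ONine) = 1 - ⟨zeta 9 ℚ_[3] KNine, zeta_mem⟩ :=
    Subtype.ext (by simp)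
  rw [e, map_sub, map_one, residueMap_zeta, sub_self]

/-- Every reduction map sends the unit `θ = 1 − 3ϖ + … − 2ϖ⁵` (`ϖ = 1 − ζ₉`) to `1`. [folklore] -/
theorem residueMap_theta (ρ : ONine →+* ZMod 3) :
    ρ ⟨1 - 3 * (1 - zeta 9 ℚ_[3] KNine) + 6 * (1 - zeta 9 ℚ_[3] KNine) ^ 2 - 7 * (1 - zeta 9 ℚ_[3] KNine) ^ 3
      + 5 * (1 - zeta 9 ℚ_[3] KNine) ^ 4 - 2 * (1 - zeta 9 ℚ_[3] KNine) ^ 5, theta_mem⟩ = 1 := by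
  have e : (⟨1 - 3 * (1 - zeta 9 ℚ_[3] KNine) + 6 * (1 - zeta 9 ℚ_[3] KNine) ^ 2 - 7 * (1 - zeta 9 ℚ_[3] KNine) ^ 3
      + 5 * (1 - zeta 9 ℚ_[3] KNine) ^ 4 - 2 * (1 - zeta 9 ℚ_[3] KNine) ^ 5, theta_mem⟩ : ONine) =
      1 - 3 * ⟨1 - zeta 9 ℚ_[3] KNine, one_sub_zeta_mem⟩ + 6 * ⟨1 - zeta 9 ℚ_[3] KNine, one_sub_zeta_mem⟩ ^ 2
        - 7 * ⟨1 - zeta 9 ℚ_[3] KNine, one_sub_zeta_mem⟩ ^ 3 + 5 * ⟨1 - zeta 9 ℚ_[3] KNine, one_sub_zeta_mem⟩ ^ 4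
        - 2 * ⟨1 - zeta 9 ℚ_[3] KNine, one_sub_zeta_mem⟩ ^ 5 :=
    Subtype.ext (by push_cast; ring)
  rw [e]
  simp only [map_add, map_sub, map_mul, map_pow, map_one, map_ofNat, residueMap_one_sub_zeta]
  norm_num

/-- Every reduction map sends `θ⁻¹ = −10 − 11ζ − 7ζ² − 10ζ³ − 4ζ⁴ + 4ζ⁵` to `1` (`≡ −38 ≡ 1 (mod 3)` at `ζ = 1`).
[folklore] -/
theorem residueMap_thetaInv (ρ : ONine →+* ZMod 3) :
    ρ ⟨-10 - 11 * zeta 9 ℚ_[3] KNine - 7 * zeta 9 ℚ_[3] KNine ^ 2 - 10 * zeta 9 ℚ_[3] KNine ^ 3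
      - 4 * zeta 9 ℚ_[3] KNine ^ 4 + 4 * zeta 9 ℚ_[3] KNine ^ 5, thetaInv_mem⟩ = 1 := by
  have e : (⟨-10 - 11 * zeta 9 ℚ_[3] KNine - 7 * zeta 9 ℚ_[3] KNine ^ 2 - 10 * zeta 9 ℚ_[3] KNine ^ 3
      - 4 * zeta 9 ℚ_[3] KNine ^ 4 + 4 * zeta 9 ℚ_[3] KNine ^ 5, thetaInv_mem⟩ : ONine) =
      -10 - 11 * ⟨zeta 9 ℚ_[3] KNine, zeta_mem⟩ - 7 * ⟨zeta 9 ℚ_[3] KNine, zeta_mem⟩ ^ 2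
        - 10 * ⟨zeta 9 ℚ_[3] KNine, zeta_mem⟩ ^ 3 - 4 * ⟨zeta 9 ℚ_[3] KNine, zeta_mem⟩ ^ 4
        + 4 * ⟨zeta 9 ℚ_[3] KNine, zeta_mem⟩ ^ 5 :=
    Subtype.ext (by push_cast; ring)
  rw [e]
  simp only [map_add, map_sub, map_neg, map_mul, map_pow, map_ofNat, residueMap_zeta]
  decide

/-- **Computing a reduction map**: if `x − a ∈ (1 − ζ₉)·𝓞` for an integer `a`, then `ρ x = a` for EVERY
reduction map `ρ` (so the special fibre of an explicit model over `𝓞` does not depend on `ρ`). [folklore] -/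
theorem residueMap_eq_of_sub_eq_mul (ρ : ONine →+* ZMod 3) {x : ONine} {a : ℤ} {y : KNine} (hy : y ∈ ONine)
    (h : (x : KNine) - a = (1 - zeta 9 ℚ_[3] KNine) * y) : ρ x = a := by
  have e : x - (a : ONine) = ⟨1 - zeta 9 ℚ_[3] KNine, one_sub_zeta_mem⟩ * ⟨y, hy⟩ :=
    Subtype.ext (by push_cast; exact h)
  have := congrArg ρ e
  rw [map_sub, map_intCast, map_mul, residueMap_one_sub_zeta, zero_mul, sub_eq_zero] at this
  exact this

end Summit.BirchSwinnertonDyer.BirchSwinnertonDyer.Theorems.NineIntegers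

end
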